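import Literature.NumberTheory.GaloisCohomology.Howard2004.DualityDatumSelmerTransferProofs
import Literature.NumberTheory.GaloisCohomology.Howard2004.DVRSettingEngineLocalInputsProofs
import Literature.NumberTheory.GaloisCohomology.Howard2004.DVRSettingFrobeniusCharacterProofs
import Literature.NumberTheory.GaloisCohomology.Howard2004.SelfOrthogonalOfIsotropicCountProofs
import Literature.NumberTheory.GaloisCohomology.Howard2004.InertTransverseDecompositionOfUnitsProofs
import Literature.NumberTheory.GaloisCohomology.Howard2004.TransverseScalarStableProofs
import Literature.NumberTheory.GaloisCohomology.Howard2004.ResidualOrthogonalityIsotropyProofs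
import Literature.NumberTheory.GaloisCohomology.Howard2004.ResidualTateDualBijectiveProofs
import Literature.NumberTheory.GaloisCohomology.Howard2004.ResidualDualityDatumProofs
import Literature.NumberTheory.GaloisCohomology.Howard2004.ResidualSelmerEigenpartsProofs
import Literature.RingTheory.CompleteLocalRings.ChainRingFrobeniusCharacter
import HarnessLib

/-!
# Howard 2004, §1.3 H.4 for `𝓕(n)` and Thm. 1.4.2 proof «identify `H¹_{𝓕*}(K, T*) ≅ H¹_𝓕(K, T)`» AT EVERY LEVEL `j` of a
# `DVRSetting`: H.4 for `𝓕(n)_j`, the local-condition match `Θ_{j*}(transport_v 𝓕(n)_{j,σv}) = 𝓕(n)_{j,v}^*`, the dual slot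
# `Ψ_j : H¹_{𝓕(n)_j}(K, T^{(j)}) ≃ H¹_{𝓕(n)_j^*}(K, T^{(j)∨}(1))`, and its residual twin for `(T̄, F̄_k(n))` (theorems only)

Topic `NumberTheory/GaloisCohomology/Howard2004`. THEOREMS ONLY: no definition, no named fact, no instance, no notation,
no `sorry`.  Cell `pub/bsd-print-x9` (seat x10b-p1-w7 g12, brick «C451-CL Q4, slice 3 = LEVEL INSTANTIATION at every `j`»,
ruling «GO w7: slice 3 at EVERY level j» of `bsd-line-x10b-p1` LEAD g14 2026-08-29T14:41:31Z; `--supports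
stmt-BirchSwinnertonDyer-22642`).  Instantiates the generic files `ConjugationTwistTransferProofs` (slice 1) and
`DualityDatumSelmerTransferProofs` (slice 2) at the level-`j` representation `T^{(j)}` of a `DVRSetting` `S` with H.0–H.5 and
`p ∤ #𝓞_K^×`, the H.4 datum `S.D j` over the level ring `R_j = R/𝔪^{e_j}`, and Howard's structure
`𝓕(n)_j = ((S.t j).atLevel j̄ n).cond` (`𝓕` modified transversally at the primes of `n`, `n ⊆ 𝓛^{(j)}`), and (§5) at the
residual representation `T̄` with the modified residual structure `F̄_k(n) = F̄_k.modify 𝒯̄ ∅ ∅ n` (all inputs already in the tree: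
`exists_residualDualityDatum`, `exists_residual_toTateDual_bijective`, `isSelfOrthogonal_residualStructure_modify`,
`isScalarStable_residualStructure_modify`, `galoisCohomology_rhobar_toLocal_inl_eq_zero`).

* §0 LETTERS.  `pow_natCast_smul_eq_zero_level` (`p^{k'} T^{(j)} = 0` for `p^{k'} ∈ 𝔪^{e_j}`);
  **`toTateDual_bijective_level`**: `Θ_j = (S.D j).toTateDual λ exp` is BIJECTIVE for EVERY Frobenius character `λ` of `R_j`
  (`T^{(j)}` free of rank two, H.0; `bijective_comp_linearMap_of_free`); `exists_frobenius_toTateDual_bijective_level`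
  (some Frobenius `λ` of `R_j` with `Θ_j` bijective — the level twin of `exists_residual_toTateDual_bijective`).
* §1 **`isSelfOrthogonal_atLevel`** — H.4 for `𝓕(n)_j` at EVERY finite place under `hu : p ∤ #𝓞_K^×`, `n ⊆ 𝓛^{(j)}`: off `n`
  it is `hy.h4 j` (`isSelfOrthogonal_of_eq_off`; `n` is `σ`-stable), on `n` the transverse condition is its own exact
  annihilator (`isSelfOrthogonalAt_of_transverse`: trivial local actions `DVRSettingLevelTrivialityProofs`, tame generator,
  `φ_v` and the ring class groups, and the count `#H¹_tr(K_v)·#H¹_tr(K_{σv}) = #H¹(K_v, T^{(j)})` under `hu`,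
  `natCard_transverseStructure_mul_eq_of_isDegreeTwo_of_not_dvd_card_units`).
* §2 `isScalarStable_atLevel` (`𝓕(n)_j` is `R_j`-stable), `mem_atLevel_cond_inl` / `mem_dualSelmerStructure_inl` (both
  structures are total at the complex place: `H¹(K_∞, T^{(j)}) = 0`).
* §3 LOCAL MATCH at level `j`: **`map_toTateDual_transportH1_atLevel_le_dualLocalCondition`** (`⊆`, ANY `ℤ_p`-semilinear `λ`
  — the half Q6 consumes at `j = t+1`) and `map_toTateDual_transportH1_atLevel_eq_dualLocalCondition` (`=`, Frobenius `λ`).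
* §4 THE SLOT: **`exists_addEquiv_selmerGroup_atLevel_dualSelmerGroup`** — for a Frobenius `λ` and the transfer `Ψ` along
  `Θ_j` (cocycle formula `hΨ` of slice 1): an additive bijection `H¹_{𝓕(n)_j}(K, T^{(j)}) ≃ H¹_{𝓕(n)_j^*}(K, T^{(j)∨}(1))`
  agreeing with `Ψ`; `exists_level_dualSlot` packages `λ, Ψ, e` (the `j = 0` instance is the slot Q7 consumes).
* §5 RESIDUAL TWIN: **`exists_residual_dualSlot`** — the same for `(T̄, F̄_k(n))` at every level `k` (residual datum `D̄` with the
  H.4/H.5(c) clauses, Frobenius `λ`, `Θ̄` bijective, transfer `Ψ̄`, bijection `H¹_{F̄_k(n)}(K, T̄) ≃ H¹_{F̄_k(n)^*}(K, T̄^∨(1))`) — the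
  `𝓗(n)[𝔪]`-currency of the engine's «(H.5 application)» (`ResidualLevelControlProofs`).

HONEST FRAMING: no pairing is constructed; Prop. 1.4.1 / C45.1″ / Thm. 1.6.1 are NOT proved; no summit statement is proved;
the Birch–Swinnerton-Dyer conjecture is not proved by any of this.
-/

set_option autoImplicit false

noncomputable section

open Function NumberField IsDedekindDomain Field CategoryTheory
open scoped NumberField ContRepresentation

namespace Literature.NumberTheory.GaloisCohomology.Howard2004

open Literature.NumberTheory.GaloisRepresentations
open Literature.NumberTheory.GaloisRepresentations.DiscreteGaloisModule
open Literature.NumberTheory.GaloisCohomology (LocalInvariants)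
open Literature.RingTheory.CompleteLocalRings

namespace DVRSetting

variable {p : ℕ} [Fact p.Prime] {K : Type} [Field K] [NumberField K]
  {R : Type} [CommRing R] [IsDomain R] [IsDiscreteValuationRing R] [Algebra ℤ_[p] R]
  {N : ℕ → Type} [∀ k, AddCommGroup (N k)] [∀ k, TopologicalSpace (N k)]
  [∀ k, DiscreteTopology (N k)] [∀ k, Module R (N k)]
  {Rk : ℕ → Type} [∀ k, CommRing (Rk k)] [∀ k, IsLocalRing (Rk k)] [∀ k, TopologicalSpace (Rk k)]
  [∀ k, DiscreteTopology (Rk k)] [∀ k, Algebra ℤ_[p] (Rk k)] [∀ k, Algebra R (Rk k)]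
  [∀ k, Module (Rk k) (N k)] [∀ k, IsScalarTower R (Rk k) (N k)]
  {Nbar : Type} [AddCommGroup Nbar] [TopologicalSpace Nbar] [DiscreteTopology Nbar]
  [∀ k, Module (Rk k) Nbar]
  {Nq : ℕ → Finset (HeightOneSpectrum (𝓞 K)) → Type} [∀ k n, AddCommGroup (Nq k n)]
  [∀ k n, TopologicalSpace (Nq k n)] [∀ k n, DiscreteTopology (Nq k n)]
  [∀ k n, Module (Rk k) (Nq k n)] [∀ k n, Module R (Nq k n)]
  [∀ k n, IsScalarTower R (Rk k) (Nq k n)]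

/-! ## §0 Letters at the level `j` -/

/-- `p^{k'} · T^{(j)} = 0` as soon as `p^{k'} ∈ 𝔪^{e_j}` (`𝔪^{e_j}` kills the level, H: `killed`).
[cite: Howard2004HeegnerKolyvagin, §1.6 (arXiv:1202.6340 p. 11 L13–17, L33–36)] -/
theorem pow_natCast_smul_eq_zero_level (S : DVRSetting p K R N Rk Nbar Nq) (hy : S.SatisfiesH) (j : ℕ) {k' : ℕ}
    (hk' : ((p : ℕ) : R) ^ k' ∈ IsLocalRing.maximalIdeal R ^ S.e j) (y : N j) : p ^ k' • y = 0 := by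
  have h := hy.killed j _ hk' y
  rwa [← Nat.cast_pow, Nat.cast_smul_eq_nsmul] at h

/-- **`Θ_j : Tw(T^{(j)}) ⥲ Hom(T^{(j)}, μ_{p^{k'}})` is bijective for EVERY Frobenius character `λ` of `R_j`** (`r ↦ λ(r ·)`
bijective), every bijective equivariant trivialisation `exp` and the H.4 datum `S.D j`: `T^{(j)}` is free of rank two over
`R_j` (H.0), so `φ ↦ λ ∘ φ : Hom_{R_j}(T^{(j)}, R_j) ≅ Hom(T^{(j)}, ℤ/p^{k'})` (`bijective_comp_linearMap_of_free`) and
`DualityDatum.toTateDual_bijective` applies. [cite: Howard2004HeegnerKolyvagin, §1.3 H.0/H.4 and §2.1 (arXiv:1202.6340 p. 7 L57–82, p. 13 L20–24)] [cite: Wood1999DualityCodesFiniteRings, Thm. 3.10] -/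
theorem toTateDual_bijective_level [∀ k, Finite (N k)] (S : DVRSetting p K R N Rk Nbar Nq) (hy : S.SatisfiesH) (j : ℕ)
    {k' : ℕ} (exp : ZMod (p ^ k') →+ MuCarrier K (p ^ k'))
    (hexp : ∀ (g : absoluteGaloisGroup K) (x : ZMod (p ^ k')),
      exp (cyclotomicCharacterModPow K p k' g * x) = mu K (p ^ k') g (exp x))
    (hexpb : Bijective exp) (lam : Rk j →+ ZMod (p ^ k'))
    (hlam : ∀ (z : ℤ_[p]) (a : Rk j), lam (algebraMap ℤ_[p] (Rk j) z * a) = PadicInt.toZModPow k' z * lam a)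
    (hfrob : Bijective ((AddMonoidHom.mul : Rk j →+ Rk j →+ Rk j).compr₂ lam)) :
    Bijective ((S.D j).toTateDual lam hlam exp hexp) := by
  haveI : Finite (Rk j) := S.finite_coeffLevel hy j
  haveI : Module.Free (Rk j) (N j) := (hy.h0 j).1
  haveI : Module.Finite (Rk j) (N j) := Module.finite_of_finrank_eq_succ (hy.h0 j).2
  exact (S.D j).toTateDual_bijective lam hlam exp hexp hexpb (bijective_comp_linearMap_of_free lam hfrob)

/-- **A Frobenius character `λ` of `R_j` with `Θ_j` bijective**, for `p^{k'} ∈ 𝔪^{e_j}` and a bijective trivialisation `exp`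
(the level twin of `exists_residual_toTateDual_bijective`; `λ` from `exists_frobeniusCharacter_levelRing`, automatically
`ℤ_p`-semilinear). [cite: Howard2004HeegnerKolyvagin, §1.3 H.4 and §2.1 (arXiv:1202.6340 p. 7 L69–82, p. 13 L20–24)] [cite: Wood1999DualityCodesFiniteRings, Thm. 3.10] -/
theorem exists_frobenius_toTateDual_bijective_level [∀ k, Finite (N k)] (S : DVRSetting p K R N Rk Nbar Nq)
    (hy : S.SatisfiesH) (j : ℕ) {k' : ℕ} (hk' : ((p : ℕ) : R) ^ k' ∈ IsLocalRing.maximalIdeal R ^ S.e j)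
    (exp : ZMod (p ^ k') →+ MuCarrier K (p ^ k'))
    (hexp : ∀ (g : absoluteGaloisGroup K) (x : ZMod (p ^ k')),
      exp (cyclotomicCharacterModPow K p k' g * x) = mu K (p ^ k') g (exp x))
    (hexpb : Bijective exp) :
    ∃ (lam : Rk j →+ ZMod (p ^ k'))
      (hlam : ∀ (z : ℤ_[p]) (a : Rk j), lam (algebraMap ℤ_[p] (Rk j) z * a) = PadicInt.toZModPow k' z * lam a),
      Bijective ((AddMonoidHom.mul : Rk j →+ Rk j →+ Rk j).compr₂ lam) ∧
        Bijective ((S.D j).toTateDual lam hlam exp hexp) := by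
  obtain ⟨lam, hfrob⟩ := S.exists_frobeniusCharacter_levelRing hy j hk'
  exact ⟨lam, apply_algebraMap_mul_eq_toZModPow_mul (S.natCast_pow_smul_levelRing_eq_zero hy j hk') lam, hfrob,
    S.toTateDual_bijective_level hy j exp hexp hexpb lam _ hfrob⟩

/-! ## §1 H.4 for `𝓕(n)_j` under `p ∤ #𝓞_K^×` -/

/-- **H.4 for Howard's structure `𝓕(n)` at the level `j`** (`n ⊆ 𝓛^{(j)}`, `p ∤ #𝓞_K^×`): `𝓕(n)_j = ((S.t j).atLevel j̄ n).cond`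
is its own exact orthogonal complement under `⟨x, transport_v y⟩_v` at EVERY finite place `v` — off `n` by H.4 for `𝓕`
(`hy.h4 j`; `n` is `σ`-stable, its primes being inert), at `v ∈ n` because the transverse condition `H¹_tr(K_v, T^{(j)})` is
isotropic and `#H¹_tr(K_v, T^{(j)}) · #H¹_tr(K_{σv}, T^{(j)}) = #H¹(K_v, T^{(j)})` (Prop. 1.1.9 under `hu`).  The readings use
some Frobenius character of `R_j` (internal), a bijective trivialisation `exp` of `μ_{p^{k'}}`, `p^{k'} ∈ 𝔪^{e_j}`, and local
Tate duality for the family `inv` (`IsPerfect`).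
[cite: Howard2004HeegnerKolyvagin, §1.3 H.4 for `𝓕(n)` (arXiv:1202.6340 p. 7 L69–82), Prop. 1.1.9, Def. 1.2.2, Lemma 1.5.6 (p. 10 L86–88)] [cite: MilneADT2006, Ch. I Cor. 2.3] -/
theorem isSelfOrthogonal_atLevel [∀ k, Finite (N k)] (S : DVRSetting p K R N Rk Nbar Nq) (hy : S.SatisfiesH)
    (hu : ¬ p ∣ Nat.card (𝓞 K)ˣ) (j : ℕ) {k' : ℕ} (hk' : ((p : ℕ) : R) ^ k' ∈ IsLocalRing.maximalIdeal R ^ S.e j)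
    (exp : ZMod (p ^ k') →+ MuCarrier K (p ^ k'))
    (hexp : ∀ (g : absoluteGaloisGroup K) (x : ZMod (p ^ k')),
      exp (cyclotomicCharacterModPow K p k' g * x) = mu K (p ^ k') g (exp x))
    (hexpb : Bijective exp) (inv : LocalInvariants K (p ^ k')) (hperf : inv.IsPerfect)
    {n : Finset (HeightOneSpectrum (𝓞 K))} (hn : ↑n ⊆ S.levelPrimes j) :
    (S.D j).IsSelfOrthogonal ((S.t j).atLevel S.jbar n).cond := by
  haveI : Finite (Rk j) := S.finite_coeffLevel hy j
  have hp : p.Prime := Fact.out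
  have hRk : ∀ r : Rk j, p ^ S.e j • r = 0 :=
    S.natCast_pow_smul_levelRing_eq_zero hy j (S.natCast_pow_mem_maximalIdeal_pow_of_le hy le_rfl)
  have hodd : Odd (p ^ S.e j) := (hp.odd_of_ne_two hy.p_odd).pow
  obtain ⟨lam, hlam, hfrob, hΘ⟩ := S.exists_frobenius_toTateDual_bijective_level hy j hk' exp hexp hexpb
  refine (S.D j).isSelfOrthogonal_of_eq_off (S.t j).cond _ (↑n : Set (HeightOneSpectrum (𝓞 K)))
    (fun v hv => ?_) (fun v hv => ?_) (hy.h4 j) (fun v hv => ?_)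
  · rw [Finset.mem_coe] at hv ⊢
    rw [S.sigma_smul_eq_self_of_mem_L hy (hn hv).1]; exact hv
  · rw [Finset.mem_coe] at hv
    exact (S.t j).atLevel_cond_inr_of_not_mem S.jbar hv
  · rw [Finset.mem_coe] at hv
    have hvlev : v ∈ S.levelPrimes j := hn hv
    have hfix : S.cd.σ • v = v := S.sigma_smul_eq_self_of_mem_L hy hvlev.1
    have hσv : S.cd.σ • v ∈ n := by rw [hfix]; exact hv
    have hℓ0 : residueChar v ≠ 0 := (prime_residueChar v).ne_zero
    have hchar : residueChar (S.cd.σ • v) = residueChar v := S.residueChar_sigma_smul_of_mem_L hy hvlev.1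
    obtain ⟨σ₀, -, hcyc⟩ := exists_forall_pow_inv_mul_mem_localRingClassSubgroup_of_isDegreeTwo' hy.imagQuad S.jbar
      (S.isDegreeTwo_of_mem_L hy hvlev.1)
    have htriv : ∀ (g : absoluteGaloisGroup (v.adicCompletion K)) (x : N j), GaloisRep.toLocal v (S.T.ρ j) g x = x :=
      fun g x => S.toLocal_apply_eq_self_of_subset_levelPrimes hy hn hv g x
    have htriv' : ∀ (g : absoluteGaloisGroup ((S.cd.σ • v).adicCompletion K)) (x : N j),
        GaloisRep.toLocal (S.cd.σ • v) (S.T.ρ j) g x = x :=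
      fun g x => S.toLocal_sigma_smul_apply_eq_self_of_subset_levelPrimes hy hn hv g x
    have h𝓣v : ((S.t j).atLevel S.jbar n).cond (Sum.inr v) = transverseCondition p (S.T.ρ j) (residueChar v) S.jbar v :=
      (S.t j).atLevel_cond_inr_of_mem S.jbar hv
    have h𝓣v' : ((S.t j).atLevel S.jbar n).cond (Sum.inr (S.cd.σ • v)) =
        transverseCondition p (S.T.ρ j) (residueChar v) S.jbar (S.cd.σ • v) := by
      rw [(S.t j).atLevel_cond_inr_of_mem S.jbar hσv, hchar]
    refine (S.D j).isSelfOrthogonalAt_of_transverse lam hlam exp hexp (S.pow_natCast_smul_eq_zero_level hy j hk')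
      hΘ inv hperf (residueChar v) S.jbar v _ h𝓣v h𝓣v' htriv htriv'
      (fun g x => S.toLocal_twist_apply_eq_self_of_subset_levelPrimes hy hn hv g x)
      (S.exists_pow_p_smul_eq_zero_level hy j) hodd hRk σ₀ hcyc
      (fun g hg => S.cd.φ_mem_localRingClassSubgroup hy.imagQuad S.jbar hℓ0 v hg) ?_
    rw [h𝓣v, (S.t j).atLevel_cond_inr_of_mem S.jbar hσv]
    exact natCard_transverseStructure_mul_eq_of_isDegreeTwo_of_not_dvd_card_units p hy.imagQuad hu (S.T.ρ j) S.jbar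
      (S.isDegreeTwo_of_mem_L hy hvlev.1) hchar htriv htriv' (S.exists_pow_p_smul_eq_zero_level hy j)
      (S.residueChar_succ_smul_eq_zero_of_mem_levelPrimes hy hvlev)

/-! ## §2 `R_j`-stability and the complex place -/

/-- **`𝓕(n)_j` is `R_j`-stable**: every local condition of `((S.t j).atLevel j̄ n).cond` is stable under `H¹(r•)`, `r ∈ R_j`
(H: `cond_smul` through `R ↠ R_j`; the transverse conditions are submodules).
[cite: Howard2004HeegnerKolyvagin, Def. 1.1.1, Def. 1.1.10 and Def. 1.2.2 (arXiv:1202.6340 p. 5 L20–24, p. 6 L14–24, L101–125)] -/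
theorem isScalarStable_atLevel (S : DVRSetting p K R N Rk Nbar Nq) (hy : S.SatisfiesH) (j : ℕ)
    (n : Finset (HeightOneSpectrum (𝓞 K))) : ((S.t j).atLevel S.jbar n).cond.IsScalarStable (hy.scalarLinear j) :=
  SelmerStructure.IsScalarStable.modify (hy.scalarLinear j) (hy.isScalarStable_cond j)
    (isScalarStable_transverseStructure p (hy.scalarLinear j) S.jbar) ∅ ∅ n

/-- `𝓕(n)_j` is total at every infinite place: `H¹(K_w, T^{(j)}) = 0` (`p` odd).
[cite: Howard2004HeegnerKolyvagin, Def. 1.1.10 (arXiv:1202.6340 p. 6 L10–14)] [cite: NeukirchSchmidtWingberg2008, (8.6.10)(ii)] -/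
theorem mem_atLevel_cond_inl (S : DVRSetting p K R N Rk Nbar Nq) (hy : S.SatisfiesH) (j : ℕ)
    (n : Finset (HeightOneSpectrum (𝓞 K))) (w : InfinitePlace K)
    (x : galoisCohomology ((S.T.ρ j).toLocal (Sum.inl w)) 1) : x ∈ ((S.t j).atLevel S.jbar n).cond (Sum.inl w) := by
  haveI := S.subsingleton_galoisCohomology_toLocal_inl_level hy j w (le_refl 1)
  rw [Subsingleton.elim x 0]
  exact AddSubgroup.zero_mem _

/-- The dual structure `𝓛^*` of ANY structure `𝓛` on `T^{(j)}` is total at every infinite place (`H¹(K_w, T^{(j)}) = 0`, so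
every class of `H¹(K_w, T^{(j)∨}(1))` is orthogonal to `𝓛_w`). [cite: Howard2004HeegnerKolyvagin, Def. 1.1.6 / 1.1.10 (arXiv:1202.6340 p. 5–6)] [cite: MilneADT2006, Ch. I Cor. 2.3] -/
theorem mem_dualSelmerStructure_inl [∀ k, Finite (N k)] (S : DVRSetting p K R N Rk Nbar Nq) (hy : S.SatisfiesH) (j : ℕ)
    {n₀ : ℕ} (inv : LocalInvariants K n₀) (𝓛 : SelmerStructure (S.T.ρ j)) (w : InfinitePlace K)
    (x : galoisCohomology (((S.T.ρ j).tateDual n₀).toLocal (Sum.inl w)) 1) :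
    x ∈ inv.dualSelmerStructure (S.T.ρ j) 𝓛 (Sum.inl w) := by
  haveI := S.subsingleton_galoisCohomology_toLocal_inl_level hy j w (le_refl 1)
  rw [LocalInvariants.dualSelmerStructure_apply, LocalInvariants.mem_dualLocalCondition_iff]
  intro a _
  rw [Subsingleton.elim a 0, map_zero, AddMonoidHom.zero_apply]

/-! ## §3 The local-condition match at the level `j` -/

/-- **`Θ_{j*}(transport_v 𝓕(n)_{j,σv}) ⊆ 𝓕(n)_{j,v}^*`** at every finite `v`, for EVERY `ℤ_p`-semilinear `λ : R_j → ℤ/p^{k'}`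
(no Frobenius property, no bijectivity: only H.4 for `𝓕(n)_j`, §1, and the reading of the local cup product) — the half
consumed by the reciprocity step at the level `t+1`.
[cite: Howard2004HeegnerKolyvagin, §1.3 H.4 (arXiv:1202.6340 p. 7 L69–82) and Thm. 1.4.2 proof (p0008 L120–124)] [cite: MilneADT2006, Ch. I Cor. 2.3] -/
theorem map_toTateDual_transportH1_atLevel_le_dualLocalCondition [∀ k, Finite (N k)] (S : DVRSetting p K R N Rk Nbar Nq)
    (hy : S.SatisfiesH) (hu : ¬ p ∣ Nat.card (𝓞 K)ˣ) (j : ℕ) {k' : ℕ}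
    (hk' : ((p : ℕ) : R) ^ k' ∈ IsLocalRing.maximalIdeal R ^ S.e j)
    (exp : ZMod (p ^ k') →+ MuCarrier K (p ^ k'))
    (hexp : ∀ (g : absoluteGaloisGroup K) (x : ZMod (p ^ k')),
      exp (cyclotomicCharacterModPow K p k' g * x) = mu K (p ^ k') g (exp x))
    (hexpb : Bijective exp) (lam : Rk j →+ ZMod (p ^ k'))
    (hlam : ∀ (z : ℤ_[p]) (a : Rk j), lam (algebraMap ℤ_[p] (Rk j) z * a) = PadicInt.toZModPow k' z * lam a)
    (inv : LocalInvariants K (p ^ k')) (hperf : inv.IsPerfect)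
    {n : Finset (HeightOneSpectrum (𝓞 K))} (hn : ↑n ⊆ S.levelPrimes j) (v : HeightOneSpectrum (𝓞 K)) :
    (((S.t j).atLevel S.jbar n).cond (Sum.inr (S.cd.σ • v))).map
        ((ContinuousRep.cohomologyMap ((S.cd.twist (S.T.ρ j)).toLocal (Sum.inr v))
            (((S.T.ρ j).tateDual (p ^ k')).toLocal (Sum.inr v))
            ((S.D j).toTateDual lam hlam exp hexp).toContinuousLinearMap.toLinearMap.toAddMonoidHom
            continuous_of_discreteTopology
            (twist_semilinear_equivariant_toLocal S.cd (S.T.ρ j) ((S.T.ρ j).tateDual (p ^ k')) _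
              ((S.D j).toTateDual_semilinear lam hlam exp hexp) (Sum.inr v)) 1).comp
          (S.cd.transportH1 (S.T.ρ j) v)) ≤
      inv.dualLocalCondition (S.T.ρ j) (Sum.inr v) (((S.t j).atLevel S.jbar n).cond (Sum.inr v)) :=
  (S.D j).map_toTateDual_transportH1_le_dualLocalCondition lam hlam exp hexp _
    (S.isSelfOrthogonal_atLevel hy hu j hk' exp hexp hexpb inv hperf hn) inv v

/-- **`Θ_{j*}(transport_v 𝓕(n)_{j,σv}) = 𝓕(n)_{j,v}^*`** at every finite `v`, for a FROBENIUS character `λ` of `R_j`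
(`Θ_j` bijective, §0; H.4 for `𝓕(n)_j`, §1; `R_j`-stability, §2; `inv_v` injective from `IsPerfect`).
[cite: Howard2004HeegnerKolyvagin, Thm. 1.4.2 proof (arXiv:1202.6340 p0008 L120–124), §1.3 H.4, Def. 1.1.6] [cite: MilneADT2006, Ch. I Cor. 2.3] -/
theorem map_toTateDual_transportH1_atLevel_eq_dualLocalCondition [∀ k, Finite (N k)] (S : DVRSetting p K R N Rk Nbar Nq)
    (hy : S.SatisfiesH) (hu : ¬ p ∣ Nat.card (𝓞 K)ˣ) (j : ℕ) {k' : ℕ}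
    (hk' : ((p : ℕ) : R) ^ k' ∈ IsLocalRing.maximalIdeal R ^ S.e j)
    (exp : ZMod (p ^ k') →+ MuCarrier K (p ^ k'))
    (hexp : ∀ (g : absoluteGaloisGroup K) (x : ZMod (p ^ k')),
      exp (cyclotomicCharacterModPow K p k' g * x) = mu K (p ^ k') g (exp x))
    (hexpb : Bijective exp) (lam : Rk j →+ ZMod (p ^ k'))
    (hlam : ∀ (z : ℤ_[p]) (a : Rk j), lam (algebraMap ℤ_[p] (Rk j) z * a) = PadicInt.toZModPow k' z * lam a)
    (hfrob : Bijective ((AddMonoidHom.mul : Rk j →+ Rk j →+ Rk j).compr₂ lam))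
    (inv : LocalInvariants K (p ^ k')) (hperf : inv.IsPerfect)
    {n : Finset (HeightOneSpectrum (𝓞 K))} (hn : ↑n ⊆ S.levelPrimes j) (v : HeightOneSpectrum (𝓞 K)) :
    (((S.t j).atLevel S.jbar n).cond (Sum.inr (S.cd.σ • v))).map
        ((ContinuousRep.cohomologyMap ((S.cd.twist (S.T.ρ j)).toLocal (Sum.inr v))
            (((S.T.ρ j).tateDual (p ^ k')).toLocal (Sum.inr v))
            ((S.D j).toTateDual lam hlam exp hexp).toContinuousLinearMap.toLinearMap.toAddMonoidHom
            continuous_of_discreteTopology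
            (twist_semilinear_equivariant_toLocal S.cd (S.T.ρ j) ((S.T.ρ j).tateDual (p ^ k')) _
              ((S.D j).toTateDual_semilinear lam hlam exp hexp) (Sum.inr v)) 1).comp
          (S.cd.transportH1 (S.T.ρ j) v)) =
      inv.dualLocalCondition (S.T.ρ j) (Sum.inr v) (((S.t j).atLevel S.jbar n).cond (Sum.inr v)) := by
  haveI : Finite (Rk j) := S.finite_coeffLevel hy j
  exact (S.D j).map_toTateDual_transportH1_eq_dualLocalCondition lam hlam exp hexp (hy.scalarLinear j)
    (S.natCast_pow_smul_levelRing_eq_zero hy j hk') hexpb hfrob (S.toTateDual_bijective_level hy j exp hexp hexpb lam hlam hfrob)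
    _ (S.isSelfOrthogonal_atLevel hy hu j hk' exp hexp hexpb inv hperf hn)
    (fun v r x hx => S.isScalarStable_atLevel hy j n (Sum.inr v) r hx) inv (fun v => (hperf v).1.1) v

/-! ## §4 The dual slot at the level `j` -/

/-- **THE DUAL SLOT AT THE LEVEL `j`.**  For a `DVRSetting` with H.0–H.5 and `p ∤ #𝓞_K^×`, `p^{k'} ∈ 𝔪^{e_j}`, a bijective
equivariant trivialisation `exp : ℤ/p^{k'} ≅ μ_{p^{k'}}`, a FROBENIUS character `λ` of `R_j`, a family `inv` with local Tate
duality, `n ⊆ 𝓛^{(j)}`, and the transfer `Ψ : H¹(K, T^{(j)}) → H¹(K, T^{(j)∨}(1))`, `[φ] ↦ [g ↦ Θ_j(φ(g^τ))]` (cocycle formula of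
`exists_conjTransfer`): there is an additive BIJECTION `H¹_{𝓕(n)_j}(K, T^{(j)}) ≃ H¹_{𝓕(n)_j^*}(K, T^{(j)∨}(1))` agreeing with `Ψ`
— Howard's «we may identify `H¹_{𝓕*}(K, T*) ≅ H¹_𝓕(K, T)`» for `(T^{(j)}, 𝓕(n)_j)`.
[cite: Howard2004HeegnerKolyvagin, Thm. 1.4.2 proof (arXiv:1202.6340 p0008 L120–124), §1.3 H.4/H.5, Def. 1.1.6, Lemma 1.5.1] [cite: MilneADT2006, Ch. I Cor. 2.3] -/
theorem exists_addEquiv_selmerGroup_atLevel_dualSelmerGroup [∀ k, Finite (N k)] (S : DVRSetting p K R N Rk Nbar Nq)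
    (hy : S.SatisfiesH) (hu : ¬ p ∣ Nat.card (𝓞 K)ˣ) (j : ℕ) {k' : ℕ}
    (hk' : ((p : ℕ) : R) ^ k' ∈ IsLocalRing.maximalIdeal R ^ S.e j)
    (exp : ZMod (p ^ k') →+ MuCarrier K (p ^ k'))
    (hexp : ∀ (g : absoluteGaloisGroup K) (x : ZMod (p ^ k')),
      exp (cyclotomicCharacterModPow K p k' g * x) = mu K (p ^ k') g (exp x))
    (hexpb : Bijective exp) (lam : Rk j →+ ZMod (p ^ k'))
    (hlam : ∀ (z : ℤ_[p]) (a : Rk j), lam (algebraMap ℤ_[p] (Rk j) z * a) = PadicInt.toZModPow k' z * lam a)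
    (hfrob : Bijective ((AddMonoidHom.mul : Rk j →+ Rk j →+ Rk j).compr₂ lam))
    (inv : LocalInvariants K (p ^ k')) (hperf : inv.IsPerfect)
    {n : Finset (HeightOneSpectrum (𝓞 K))} (hn : ↑n ⊆ S.levelPrimes j)
    (Ψ : galoisCohomology (S.T.ρ j) 1 →+ galoisCohomology ((S.T.ρ j).tateDual (p ^ k')) 1)
    (hΨ : ∀ (φ : contOneCocycles (S.T.ρ j).toTopRep) (ψ : contOneCocycles ((S.T.ρ j).tateDual (p ^ k')).toTopRep),
      (∀ g, ψ.1 g = ((S.D j).toTateDual lam hlam exp hexp).toContinuousLinearMap.toLinearMap.toAddMonoidHom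
        (φ.1 (S.cd.conj g))) → Ψ (oneCocycleClass _ φ) = oneCocycleClass _ ψ) :
    ∃ e : ↥((S.t j).atLevel S.jbar n).cond.selmerGroup ≃+
        ↥(inv.dualSelmerStructure (S.T.ρ j) ((S.t j).atLevel S.jbar n).cond).selmerGroup,
      ∀ c, ((e c : ↥(inv.dualSelmerStructure (S.T.ρ j) ((S.t j).atLevel S.jbar n).cond).selmerGroup) :
        galoisCohomology ((S.T.ρ j).tateDual (p ^ k')) 1) = Ψ c := by
  haveI : Finite (Rk j) := S.finite_coeffLevel hy j
  exact (S.D j).exists_addEquiv_selmerGroup_dualSelmerGroup lam hlam exp hexp (hy.scalarLinear j)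
    (S.natCast_pow_smul_levelRing_eq_zero hy j hk') hexpb hfrob (S.toTateDual_bijective_level hy j exp hexp hexpb lam hlam hfrob)
    _ (S.isSelfOrthogonal_atLevel hy hu j hk' exp hexp hexpb inv hperf hn)
    (fun v r x hx => S.isScalarStable_atLevel hy j n (Sum.inr v) r hx) (fun w x => S.mem_atLevel_cond_inl hy j n w x)
    inv (fun v => (hperf v).1.1) (fun w x => S.mem_dualSelmerStructure_inl hy j inv _ w x) Ψ hΨ

/-- **The dual slot at the level `j`, packaged**: some Frobenius character `λ` of `R_j` (with `Θ_j` bijective), the transfer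
`Ψ` along `Θ_j` and the bijection `H¹_{𝓕(n)_j}(K, T^{(j)}) ≃ H¹_{𝓕(n)_j^*}(K, T^{(j)∨}(1))` agreeing with `Ψ`.
[cite: Howard2004HeegnerKolyvagin, Thm. 1.4.2 proof (arXiv:1202.6340 p0008 L120–124), §1.3 H.4/H.5, §2.1] [cite: MilneADT2006, Ch. I Cor. 2.3] -/
theorem exists_level_dualSlot [∀ k, Finite (N k)] (S : DVRSetting p K R N Rk Nbar Nq) (hy : S.SatisfiesH)
    (hu : ¬ p ∣ Nat.card (𝓞 K)ˣ) (j : ℕ) {k' : ℕ} (hk' : ((p : ℕ) : R) ^ k' ∈ IsLocalRing.maximalIdeal R ^ S.e j)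
    (exp : ZMod (p ^ k') →+ MuCarrier K (p ^ k'))
    (hexp : ∀ (g : absoluteGaloisGroup K) (x : ZMod (p ^ k')),
      exp (cyclotomicCharacterModPow K p k' g * x) = mu K (p ^ k') g (exp x))
    (hexpb : Bijective exp) (inv : LocalInvariants K (p ^ k')) (hperf : inv.IsPerfect)
    {n : Finset (HeightOneSpectrum (𝓞 K))} (hn : ↑n ⊆ S.levelPrimes j) :
    ∃ (lam : Rk j →+ ZMod (p ^ k'))
      (hlam : ∀ (z : ℤ_[p]) (a : Rk j), lam (algebraMap ℤ_[p] (Rk j) z * a) = PadicInt.toZModPow k' z * lam a)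
      (Ψ : galoisCohomology (S.T.ρ j) 1 →+ galoisCohomology ((S.T.ρ j).tateDual (p ^ k')) 1),
      Bijective ((AddMonoidHom.mul : Rk j →+ Rk j →+ Rk j).compr₂ lam) ∧
      Bijective ((S.D j).toTateDual lam hlam exp hexp) ∧
      (∀ (φ : contOneCocycles (S.T.ρ j).toTopRep) (ψ : contOneCocycles ((S.T.ρ j).tateDual (p ^ k')).toTopRep),
        (∀ g, ψ.1 g = ((S.D j).toTateDual lam hlam exp hexp).toContinuousLinearMap.toLinearMap.toAddMonoidHom
          (φ.1 (S.cd.conj g))) → Ψ (oneCocycleClass _ φ) = oneCocycleClass _ ψ) ∧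
      ∃ e : ↥((S.t j).atLevel S.jbar n).cond.selmerGroup ≃+
          ↥(inv.dualSelmerStructure (S.T.ρ j) ((S.t j).atLevel S.jbar n).cond).selmerGroup,
        ∀ c, ((e c : ↥(inv.dualSelmerStructure (S.T.ρ j) ((S.t j).atLevel S.jbar n).cond).selmerGroup) :
          galoisCohomology ((S.T.ρ j).tateDual (p ^ k')) 1) = Ψ c := by
  obtain ⟨lam, hlam, hfrob, hΘ⟩ := S.exists_frobenius_toTateDual_bijective_level hy j hk' exp hexp hexpb
  obtain ⟨Ψ, hΨ⟩ := exists_conjTransfer S.cd (S.T.ρ j) ((S.T.ρ j).tateDual (p ^ k'))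
    ((S.D j).toTateDual lam hlam exp hexp).toContinuousLinearMap.toLinearMap.toAddMonoidHom
    ((S.D j).toTateDual_semilinear lam hlam exp hexp)
  exact ⟨lam, hlam, Ψ, hfrob, hΘ, hΨ,
    S.exists_addEquiv_selmerGroup_atLevel_dualSelmerGroup hy hu j hk' exp hexp hexpb lam hlam hfrob inv hperf hn Ψ hΨ⟩

/-! ## §5 The residual twin: the dual slot for `(T̄, F̄_k(n))` -/

/-- **THE RESIDUAL DUAL SLOT.**  On a `DVRSetting` with H.0–H.5 and `p ∤ #𝓞_K^×`, at every level `k`, for `p^{k'} ∈ 𝔪^{e_k}`, a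
bijective `Γ_K`-compatible trivialisation `exp : ℤ/p^{k'} ≅ μ_{p^{k'}}`, a family `inv` of local invariants with local Tate duality
(`IsPerfect`) and `n ⊆ 𝓛^{(k)}`: there are a residual duality datum `D̄` on `T̄` compatible with `e_k` (H.4 + H.5(c)), a Frobenius
character `λ` of `R_k`, the transfer `Ψ̄ : H¹(K, T̄) → H¹(K, T̄^∨(1))`, `[φ] ↦ [g ↦ Θ̄(φ(g^τ))]`, along
`Θ̄ = D̄.toTateDual λ exp` (bijective), and an additive BIJECTION `H¹_{F̄_k(n)}(K, T̄) ≃ H¹_{F̄_k(n)^*}(K, T̄^∨(1))` agreeing with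
`Ψ̄` — Howard's «we may identify `H¹_{𝓕*}(K, T*[𝔪]) ≅ H¹_𝓕(K, T[𝔪])`» for `𝓕(n)` at the residual level.
[cite: Howard2004HeegnerKolyvagin, Thm. 1.4.2 proof (arXiv:1202.6340 p0008 L120–124), §1.3 H.4/H.5 (p. 7 L69 – p. 8 L1), Def. 1.1.6, Lemma 1.5.1] [cite: MilneADT2006, Ch. I Cor. 2.3] -/
theorem exists_residual_dualSlot [Finite Nbar] (S : DVRSetting p K R N Rk Nbar Nq) (hy : S.SatisfiesH)
    (hu : ¬ p ∣ Nat.card (𝓞 K)ˣ) (k : ℕ) {k' : ℕ}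
    (hk' : ((p : ℕ) : R) ^ k' ∈ IsLocalRing.maximalIdeal R ^ S.e k)
    (exp : ZMod (p ^ k') →+ MuCarrier K (p ^ k'))
    (hexp : ∀ (g : absoluteGaloisGroup K) (x : ZMod (p ^ k')),
      exp (cyclotomicCharacterModPow K p k' g * x) = mu K (p ^ k') g (exp x))
    (hexpb : Bijective exp) (inv : LocalInvariants K (p ^ k')) (hperf : inv.IsPerfect)
    {n : Finset (HeightOneSpectrum (𝓞 K))} (hn : ↑n ⊆ S.levelPrimes k) :
    ∃ (Dbar : DualityDatum p S.cd S.ρbar (Rk k)) (lam : Rk k →+ ZMod (p ^ k'))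
      (hlam : ∀ (z : ℤ_[p]) (a : Rk k), lam (algebraMap ℤ_[p] (Rk k) z * a) = PadicInt.toZModPow k' z * lam a)
      (Ψ : galoisCohomology S.ρbar 1 →+ galoisCohomology (S.ρbar.tateDual (p ^ k')) 1),
      (∀ s t : N k, Dbar.e (S.πbar k s) (S.πbar k t) = algebraMap R (Rk k) S.π ^ (S.e k - 1) * (S.D k).e s t) ∧
      (∀ x y : Nbar, Dbar.e ((S.A k).θ x) ((S.A k).θ y) = -Dbar.e x y) ∧
      Bijective (Dbar.toTateDual lam hlam exp hexp) ∧
      (∀ (φ : contOneCocycles S.ρbar.toTopRep) (ψ : contOneCocycles (S.ρbar.tateDual (p ^ k')).toTopRep),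
        (∀ g, ψ.1 g = (Dbar.toTateDual lam hlam exp hexp).toContinuousLinearMap.toLinearMap.toAddMonoidHom
          (φ.1 (S.cd.conj g))) → Ψ (oneCocycleClass _ φ) = oneCocycleClass _ ψ) ∧
      ∃ e : ↥(((hy.h1 k).1.propagateStructure (S.t k).cond).modify (transverseStructure p S.ρbar S.jbar) ∅ ∅ n).selmerGroup ≃+
          ↥(inv.dualSelmerStructure S.ρbar
            (((hy.h1 k).1.propagateStructure (S.t k).cond).modify (transverseStructure p S.ρbar S.jbar) ∅ ∅ n)).selmerGroup,
        ∀ c, ((e c : ↥(inv.dualSelmerStructure S.ρbar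
            (((hy.h1 k).1.propagateStructure (S.t k).cond).modify (transverseStructure p S.ρbar S.jbar) ∅ ∅ n)).selmerGroup) :
          galoisCohomology (S.ρbar.tateDual (p ^ k')) 1) = Ψ c := by
  haveI : Finite (Rk k) := S.finite_coeffLevel hy k
  have hRk : ∀ r : Rk k, p ^ k' • r = 0 := S.natCast_pow_smul_levelRing_eq_zero hy k hk'
  -- the residual datum, the Frobenius character and `Θ̄` bijective
  obtain ⟨Dbar, hDbar, -, hθθ⟩ := S.exists_residualDualityDatum hy k
  obtain ⟨lam, hlam, hfrob, hΘ⟩ := S.exists_residual_toTateDual_bijective hy k hk' exp hexp hexpb Dbar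
  -- the transfer along `Θ̄`
  obtain ⟨Ψ, hΨ⟩ := exists_conjTransfer S.cd S.ρbar (S.ρbar.tateDual (p ^ k'))
    (Dbar.toTateDual lam hlam exp hexp).toContinuousLinearMap.toLinearMap.toAddMonoidHom
    (Dbar.toTateDual_semilinear lam hlam exp hexp)
  refine ⟨Dbar, lam, hlam, Ψ, hDbar, hθθ, hΘ, hΨ, ?_⟩
  -- H.4 for `F̄_k(n)`, its `R_k`-stability, and the infinite places
  have hso := S.isSelfOrthogonal_residualStructure_modify hy hu k hk' exp hexp Dbar hDbar lam hlam hΘ inv hperf hn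
  have hst := S.isScalarStable_residualStructure_modify hy k ∅ ∅ n
  exact Dbar.exists_addEquiv_selmerGroup_dualSelmerGroup lam hlam exp hexp (S.isScalarLinear_rhobar hy k) hRk hexpb hfrob
    hΘ _ hso (fun v r x hx => hst (Sum.inr v) r hx)
    (fun w x => by
      rw [S.galoisCohomology_rhobar_toLocal_inl_eq_zero hy w x]
      exact AddSubgroup.zero_mem _)
    inv (fun v => (hperf v).1.1)
    (fun w x => (LocalInvariants.mem_dualLocalCondition_iff _ _ _ _ _).mpr fun a _ => by
      rw [S.galoisCohomology_rhobar_toLocal_inl_eq_zero hy w a, map_zero, AddMonoidHom.zero_apply])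
    Ψ hΨ

end DVRSetting

end Literature.NumberTheory.GaloisCohomology.Howard2004

end
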